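import Summits.QuantumFields.BalabanUV.Beta.FP.ScaledResolventSandwichLetters

/-!
# `BalabanUV.Beta.FP.ScaledResolventSandwich` — road «FP» for binder row D1, W-ORACLE-K row **TRANSPORT** (§11d; first refusal leaf-02), located piece
# (T-alg) of L-d1leaf02g15-1: THE N0-SANDWICH ONE LATTICE UP — `hessKer G (vertexOfK C n V₁) (vertex2OfK C n W₁) μ ν z =
# dressedEntryP (c a ↦ colH C n a 0 c) (fineHessA G V₁ W₁) (n•(−z)) μ ν` for an INNER vertex family `V₁ κ u` bi-localised at `(L•u, L•u)` and an inner
# bi-family `W₁` at `(L•u, L•u′)` (the shapes of the level-1 vertices `vertexOfK G₁ Lc S∞` ∕ bi-vertices), a column kernel `C` on the INTERMEDIATE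
# `L`-lattice and a leg `G` on the fine lattice — the OWNER's `GenericResolventSandwich.hessKer_vertexOfK_vertex2OfK_eq_dressedEntryP` (which is `L = 1`)
# transported by DILATION to the `L`-sublattice (letters: `FP/ScaledResolventSandwichLetters`)

HONEST DEPENDENCY (page 1, mandatory): continuum YM on T⁴ ⇐ BetaPertH ∧ nine spine estimates (0/9 proved); BetaPertH ⇐ (D1) ∧ (D4) ∧ CAP+tail;
G-an2-4 gates asym, D1 and NE2/3/4.  HONEST FRAMING (cell contract, verbatim): «discharging `BetaPertH` makes Bałaban's UV stability UNCONDITIONAL —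
a real constructive-QFT result; it is NOT the continuum limit and NOT the Clay problem.»  THIS MODULE is [folklore] re-indexing of absolutely convergent
superpositions: the landed sandwich BY NAME at the dilated data, un-dilated on both sides (`dressedEntryP_extend`).  No `def`, no `def … : Prop`, nothing cited,
0 sorry; GENERIC kernels — nothing of the perfect objects instantiated; 0∕4 row-D1 binders; NOT TRANSPORT (its transported word for the `S`∕`S₂` slots, stated
abstractly — the instance needs (F-V) `ColumnSemigroupVertexNesting` + SLOT's Π-currency columns + the units against the END's `RP m`), NOT SDF, NOT D1,
NOT BetaPertH, NOT continuum, NOT Clay.  «not in print; our bookkeeping».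

ABSOLUTE RULE (cell charter, verbatim): «No internally-minted statement may enter as a cited fact. Every hypothesis is either kernel-proved in this package or a
verbatim quotation of a PUBLISHED theorem with page reference. The manuscript(s) under audit are NOT citable for their own disputed steps — they are the thing
under adjudication; programme-internal (2001/route/tribunal) claims are never citable.»

CONTENT ([folklore]; `d + 1 = 4`): `not_range_or`, **`dressedEntryP_extend`** (the sandwich un-dilates:
`dressedEntryP (c a ↦ extend (L•·) (w c a) 0) (fineHessA G V₁♯ W₁♯) (L•y) μ ν = dressedEntryP w (fineHessA G V₁ W₁) y μ ν`),
**`hessKer_vertexOfK_vertex2OfK_eq_dressedEntryP_scaled`** — the sandwich one lattice up.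
Provenance: unit `b2b-balaban-beta-d1-formalise-leaf-02` gen 15 (prover-b2b-balaban-beta-d1-formalise-leaf-02-g15-0), 2026-08-21; new file, nothing appended to others' modules.
-/

noncomputable section

namespace Summit.QuantumFields.BalabanUV.Beta.FP.ScaledResolventSandwich

open Finset Filter Topology
open scoped BigOperators
open Literature.MathematicalPhysics.QuantumFieldTheory.Balaban1983to89
open Literature.MathematicalPhysics.QuantumFieldTheory.Balaban1983to89.Beta
open B12Sec2to5 (l1 l1_nonneg)
open ExpKernelCalculus (Site MKer Decays BiLoc comp tr bubble tadpole hessKer shiftK l1_natSmul)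
open DecimatedMomentSummable (AbsMoment₂)
open OneStepResolventKernel (Fib wsum LocStencil)
open OneStepKernelFamily (colH vertexOfK)
open SecondOrderResponse (vertex2OfK)
open Summit.QuantumFields.BalabanUV.Beta.TameKernelCalculus (Spr)
open Summit.QuantumFields.BalabanUV.Beta.D1BFx.MomentTransferPeriodicSum (dressedSumP)
open Summit.QuantumFields.BalabanUV.Beta.D1BFx.MomentTransferPeriodicEntry (EKer₂ dressedEntryP)
open Summit.QuantumFields.BalabanUV.Beta.D1BFx.DressedTablesLeg (tadpoleTableA_apply bubbleTableA_apply)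
open Summit.QuantumFields.BalabanUV.Beta.D1BFx.ReducedKernelSandwichLeg (fineHessA fineHessA_apply)
open Summit.QuantumFields.BalabanUV.Beta.FP.TransportInfinityM (colOf)
open Summit.QuantumFields.BalabanUV.Beta.FP.GenericResolventSandwich (hessKer_vertexOfK_vertex2OfK_eq_dressedEntryP)
open Summit.QuantumFields.BalabanUV.Beta.FP.ScaledResolventSandwichLetters

variable {L : ℕ} [NeZero L]

section Undilate

variable {n : ℕ} {G : MKer (3 + 1) (Fib 3)} {V₁ : Fin (3 + 1) → Site (3 + 1) → MKer (3 + 1) (Fib 3)}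
  {W₁ : Fin (3 + 1) → Site (3 + 1) → Fin (3 + 1) → Site (3 + 1) → MKer (3 + 1) (Fib 3)}

omit [NeZero L] in
/-- [folklore] Off the pair-sublattice, one of the two coordinates is off the sublattice. -/
theorem not_range_or {p : Site (3 + 1) × Site (3 + 1)}
    (hp : ¬∃ q : Site (3 + 1) × Site (3 + 1), ((L : ℤ) • q.1, (L : ℤ) • q.2) = p) :
    (¬∃ u : Site (3 + 1), (L : ℤ) • u = p.1) ∨ (¬∃ u : Site (3 + 1), (L : ℤ) • u = p.2) := by
  by_cases h1 : ∃ u : Site (3 + 1), (L : ℤ) • u = p.1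
  · right
    rintro ⟨u', hu'⟩
    obtain ⟨u, hu⟩ := h1
    exact hp ⟨(u, u'), Prod.ext hu hu'⟩
  · left
    exact h1

/-- [folklore] **THE SANDWICH UN-DILATES**: for any column family `w` and the dilated data `S♯`, `W♯`,
`dressedEntryP (c a ↦ extend (L•·) (w c a) 0) (fineHessA G S♯ W♯) (L•y) μ ν = dressedEntryP w (fineHessA G V₁ W₁) y μ ν`. -/
theorem dressedEntryP_extend (w : Fin (3 + 1) → Fin (3 + 1) → Site (3 + 1) → ℝ) (y : Site (3 + 1)) (μ ν : Fin (3 + 1)) :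
    dressedEntryP (fun c a => Function.extend (fun u : Site (3 + 1) => (L : ℤ) • u) (w c a) 0)
        (fineHessA G (fun κ => Function.extend (fun u : Site (3 + 1) => (L : ℤ) • u) (V₁ κ) 0)
          (fun κ v l x => Function.extend (fun q : Site (3 + 1) × Site (3 + 1) => ((L : ℤ) • q.1, (L : ℤ) • q.2))
            (fun q => W₁ κ q.1 l q.2) 0 (v, x)))
        ((L : ℤ) • y) μ ν
      = dressedEntryP w (fineHessA G V₁ W₁) y μ ν := by
  simp only [dressedEntryP, dressedSumP]
  refine Finset.sum_congr rfl fun c _ => Finset.sum_congr rfl fun e _ => ?_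
  rw [← tsum_extend_zero (pair_injective (L := L))
    (fun q : Site (3 + 1) × Site (3 + 1) => w c μ q.1 * fineHessA G V₁ W₁ c e (y + q.1) q.2 * w e ν q.2)]
  refine tsum_congr fun p => ?_
  by_cases hp : ∃ q : Site (3 + 1) × Site (3 + 1), ((L : ℤ) • q.1, (L : ℤ) • q.2) = p
  · obtain ⟨q, rfl⟩ := hp
    rw [(pair_injective (L := L)).extend_apply]
    simp only [(zsmul_injective (L := L)).extend_apply]
    congr 2
    simp only [fineHessA_apply, tadpoleTableA_apply, bubbleTableA_apply, ← smul_add, (zsmul_injective (L := L)).extend_apply]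
    congr 3
    exact (pair_injective (L := L)).extend_apply (fun q' => W₁ c q'.1 e q'.2) 0 (y + q.1, q.2)
  · rw [Function.extend_apply' _ _ _ hp]
    rcases not_range_or hp with h1 | h2
    · rw [Function.extend_apply' _ _ _ h1]
      simp
    · rw [Function.extend_apply' _ _ _ h2]
      simp

end Undilate

/-! ## §2 The sandwich one lattice up -/

section Scaled

variable {n : ℕ} {G C : MKer (3 + 1) (Fib 3)} {CC δ Cs δs C2 δ2 : ℝ}
  {V₁ : Fin (3 + 1) → Site (3 + 1) → MKer (3 + 1) (Fib 3)}
  {W₁ : Fin (3 + 1) → Site (3 + 1) → Fin (3 + 1) → Site (3 + 1) → MKer (3 + 1) (Fib 3)}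

/-- [folklore] **THE N0-SANDWICH ONE LATTICE UP.**  Leg `G`: spread, block-covariant at blocking `n·L`.  Column kernel `C` on the INTERMEDIATE lattice:
decaying, block-covariant at blocking `n` (its own coordinates), `AbsMoment₂` columns.  Inner vertex family `V₁ κ u`: bi-localised at the FINE point `L•u`
of its bond, block-covariant (`V₁ κ (u + n•t) = shiftK (−((n·L)•t)) (V₁ κ u)`); inner bi-family `W₁` likewise at `(L•u, L•u′)`.  Then
`hessKer G (vertexOfK C n V₁) (vertex2OfK C n W₁) μ ν z = dressedEntryP (c a ↦ colH C n a 0 c) (fineHessA G V₁ W₁) (n•(−z)) μ ν` —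
`GenericResolventSandwich.hessKer_vertexOfK_vertex2OfK_eq_dressedEntryP` (the case `L = 1`) at the dilated data `(C♯, V₁♯, W₁♯)`, un-dilated on both sides. -/
theorem hessKer_vertexOfK_vertex2OfK_eq_dressedEntryP_scaled (hn : 1 ≤ n) (hG : Spr G)
    (hGcov : ∀ t : Site (3 + 1), shiftK (-(((n * L : ℕ) : ℤ) • t)) G = G)
    (hC : Decays C CC δ) (hδ : 0 < δ) (hCcov : ∀ t : Site (3 + 1), shiftK (-((n : ℤ) • t)) C = C)
    (hwA : ∀ κ l : Fin 4, AbsMoment₂ (colOf C κ l))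
    (hV : ∀ κ u, BiLoc (V₁ κ u) ((L : ℤ) • u) ((L : ℤ) • u) Cs δs) (hδs : 0 < δs)
    (hVcov : ∀ κ u t, V₁ κ (u + (n : ℤ) • t) = shiftK (-(((n * L : ℕ) : ℤ) • t)) (V₁ κ u))
    (hW : ∀ κ u l u', BiLoc (W₁ κ u l u') ((L : ℤ) • u) ((L : ℤ) • u') C2 δ2) (hδ2 : 0 < δ2)
    (hWcov : ∀ κ u l u' t, W₁ κ (u + (n : ℤ) • t) l (u' + (n : ℤ) • t) = shiftK (-(((n * L : ℕ) : ℤ) • t)) (W₁ κ u l u'))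
    (μ ν : Fin (3 + 1)) (z : Site (3 + 1)) :
    hessKer G (vertexOfK C n V₁) (vertex2OfK C n W₁) μ ν z
      = dressedEntryP (fun c a => colH C n a 0 c) (fineHessA G V₁ W₁) ((n : ℤ) • (-z)) μ ν := by
  have hnL : 1 ≤ n * L := Nat.one_le_iff_ne_zero.mpr (Nat.mul_ne_zero (by omega) (NeZero.ne L))
  have hLpos : (0 : ℝ) < L := by exact_mod_cast Nat.pos_of_ne_zero (NeZero.ne L)
  -- the dilated column kernel and its letters
  have hcol : ∀ (μ : Fin (3 + 1)) (y : Site (3 + 1)) (κ : Fin (3 + 1)),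
      colH (fun v w => Function.extend (fun q : Site (3 + 1) × Site (3 + 1) => ((L : ℤ) • q.1, (L : ℤ) • q.2))
        (fun q => C q.1 q.2) 0 (v, w)) (n * L) μ y κ
        = Function.extend (fun u : Site (3 + 1) => (L : ℤ) • u) (colH C n μ y κ) 0 := fun μ y κ => colH_extend₂ μ y κ
  have hwA' : ∀ κ l : Fin 4, AbsMoment₂ (colOf (fun v w => Function.extend
      (fun q : Site (3 + 1) × Site (3 + 1) => ((L : ℤ) • q.1, (L : ℤ) • q.2)) (fun q => C q.1 q.2) 0 (v, w)) κ l) := fun κ l => by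
    rw [colOf_extend₂]
    exact absMoment₂_extend (hwA κ l)
  -- dilate both jets
  have hVe : vertexOfK C n V₁ = vertexOfK (fun v w => Function.extend
      (fun q : Site (3 + 1) × Site (3 + 1) => ((L : ℤ) • q.1, (L : ℤ) • q.2)) (fun q => C q.1 q.2) 0 (v, w)) (n * L)
      (fun κ => Function.extend (fun u : Site (3 + 1) => (L : ℤ) • u) (V₁ κ) 0) := by
    funext μ' y'
    exact (vertexOfK_of_colH_extend hcol V₁ μ' y').symm
  have hWe : vertex2OfK C n W₁ = vertex2OfK (fun v w => Function.extend
      (fun q : Site (3 + 1) × Site (3 + 1) => ((L : ℤ) • q.1, (L : ℤ) • q.2)) (fun q => C q.1 q.2) 0 (v, w)) (n * L)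
      (fun κ v l x => Function.extend (fun q : Site (3 + 1) × Site (3 + 1) => ((L : ℤ) • q.1, (L : ℤ) • q.2))
        (fun q => W₁ κ q.1 l q.2) 0 (v, x)) := by
    funext μ' y' ν' y''
    exact (vertex2OfK_of_colH_extend hcol W₁ μ' y' ν' y'').symm
  rw [hVe, hWe, hessKer_vertexOfK_vertex2OfK_eq_dressedEntryP hnL hG hGcov (decays_extend₂ hC) (div_pos hδ hLpos)
    (shiftK_extend₂ hCcov) hwA' (locStencil_extend hV) hδs (shift_extend hVcov) (biLoc_extend₂ hW) hδ2 (shift_extend₂ hWcov) μ ν z]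
  -- un-dilate the right-hand side
  have hcol0 : (fun c a => colH (fun v w => Function.extend (fun q : Site (3 + 1) × Site (3 + 1) => ((L : ℤ) • q.1, (L : ℤ) • q.2))
        (fun q => C q.1 q.2) 0 (v, w)) (n * L) a 0 c)
      = fun c a => Function.extend (fun u : Site (3 + 1) => (L : ℤ) • u) (colH C n a 0 c) 0 := by
    funext c a
    exact hcol a 0 c
  rw [hcol0, natMul_zsmul]
  exact dressedEntryP_extend (fun c a => colH C n a 0 c) ((n : ℤ) • (-z)) μ ν

end Scaled



end Summit.QuantumFields.BalabanUV.Beta.FP.ScaledResolventSandwich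

end
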